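import Literature.Probability.RandomPlanarGeometry.HexSAWBrickWallHalfSpace
import HarnessLib

/-!
# Irreducible brick-wall bridges of the hexagonal lattice and the Lawler–Schramm–Werner renewal
# inequality `Σ_{j=1}^{n} λ_j(ℍ) h_{n-j}(ℍ) ≤ h_n(ℍ)`

Topic `Literature/Probability/RandomPlanarGeometry` (continues `HexSAWBrickWallWalks.lean` (`HexBW.saws`, `HexBW.bridges`,
`HexBW.halfSpaceWalks`; height = brick-wall coordinate `0`, parity twist `twistAt`), `HexSAWBrickWallBridges.lean`
(`HexBW.concat`) and `HexSAWBrickWallHalfSpace.lean` (`HexBW.concat_mem_halfSpaceWalks`)).  Lane «pcv-sawmu», door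
«HEX-HALFSPACE-RATIO-1» (`h_{N+1}(ℍ)/h_N(ℍ) → μ_ℍ`), pieces K1–K3.

Sources: G. Lawler, O. Schramm, W. Werner, *On the scaling limit of planar self-avoiding walk* (2004), Appendix A
(renewal times, irreducible bridges, `υ_n ≥ #{ω ∈ Υ_n : s(ω) ≤ k} = Σ_{j=1}^{k} λ_j υ_{n-j}` — printed for `ℤ^d`;
tree: `Zd.sum_irreducibleBridgeCount_mul_halfSpaceCount_le`, `SAWHalfSpaceConcat.lean`); H. Duminil-Copin, A. Hammond,
CMP 324 (2013), §2.2 (renewal points, irreducible bridges; tree predicates `Zd.IsRenewalTime`, `Zd.IsIrreducibleBridge`);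
N. Madras, G. Slade, *The Self-Avoiding Walk* (1993), §4.2 Definition 4.2.1.  The honeycomb versions below are the
same statements for the brick-wall sub-class `HexBW.bridges n ⊆ Zd.bridges 2 n`, glued with the parity twist; not
in print for `ℍ` (first kernel text).

* `HexBW.irreducibleBridges n := (HexBW.bridges n).filter (Zd.IsIrreducibleBridge n)`, `irreducibleBridgeCount n = λ_n(ℍ)`;
  `irreducibleBridgeCount_zero` (`λ_0 = 0`), `irreducibleBridgeCount_one_pos` (`0 < λ_1`), `irreducibleBridgeCount_le`
  (`λ_n ≤ b_n`);
* **`sum_irreducibleBridgeCount_mul_halfSpaceCount_le`** — `Σ_{j ∈ Icc 1 n} λ_j(ℍ) h_{n-j}(ℍ) ≤ h_n(ℍ)`: the twisted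
  gluing `(j, η, τ) ↦ HexBW.concat j η τ` of an irreducible `j`-step bridge and an `(n-j)`-step half-space walk is
  injective into the `n`-step half-space walks (`j` = the least time at which the head is a bridge and the tail a
  half-space walk; the twist does not touch heights);
* **`bridgeCount_eq_sum_Icc`** — the RENEWAL EQUATION `b_n(ℍ) = Σ_{s=1}^{n} λ_s(ℍ) b_{n-s}(ℍ)` (`n ≥ 1`, Madras–Slade
  (4.2.2) on `ℍ`): the twisted gluing `(s, η, τ) ↦ HexBW.concat s η τ` is a bijection from
  `⨆_{s=1}^{n} (irreducible s-bridges) × ((n-s)-bridges)` onto the `n`-step bridges (split at the first renewal time,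
  twist the tail: `tailTwist_mem_bridges`, `head_mem_irreducibleBridges`, `concat_head_tailTwist`);
  `bridgeCount_eq_sum_range` (Feller's indexing, over `ℝ`).
-/

noncomputable section

open Finset Function Literature.Probability.LatticeModels Literature.Probability.Percolation SimpleGraph

namespace Literature.Probability.RandomPlanarGeometry.SAW

namespace HexBW

/-! ### Irreducible brick-wall bridges -/

open Classical in
/-- The `n`-step **irreducible bridges** of the hexagonal lattice in brick-wall coordinates: brick-wall bridges
(height = coordinate `0`) with no renewal time in `[1, n-1]` (and `n ≥ 1`). [cite: DuminilCopinHammond2013, §2.2; MadrasSlade1993, §4.2, Definition 4.2.1] -/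
def irreducibleBridges (n : ℕ) : Finset (ℕ → Site 2) := (bridges n).filter (Zd.IsIrreducibleBridge n)

/-- `λ_n(ℍ)`, the number of `n`-step irreducible brick-wall bridges from the origin. [cite: DuminilCopinHammond2013, §2.2; MadrasSlade1993, §4.2, Definition 4.2.1] -/
def irreducibleBridgeCount (n : ℕ) : ℕ := #(irreducibleBridges n)

/-- Membership in `irreducibleBridges`. [cite: DuminilCopinHammond2013, §2.2] -/
theorem mem_irreducibleBridges {n : ℕ} {ω : ℕ → Site 2} :
    ω ∈ irreducibleBridges n ↔ ω ∈ bridges n ∧ Zd.IsIrreducibleBridge n ω := by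
  classical
  exact Finset.mem_filter

/-- Irreducible bridges are bridges. [cite: DuminilCopinHammond2013, §2.2] -/
theorem irreducibleBridges_subset_bridges (n : ℕ) : irreducibleBridges n ⊆ bridges n := by
  classical
  exact Finset.filter_subset _ _

/-- `λ_n(ℍ) ≤ b_n(ℍ)`. [cite: DuminilCopinHammond2013, §2.2] -/
theorem irreducibleBridgeCount_le (n : ℕ) : irreducibleBridgeCount n ≤ bridgeCount n :=
  card_le_card (irreducibleBridges_subset_bridges n)

/-- `λ_0(ℍ) = 0` (an irreducible bridge has at least one step). [cite: DuminilCopinHammond2013, §2.2] -/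
theorem irreducibleBridgeCount_zero : irreducibleBridgeCount 0 = 0 := by
  rw [irreducibleBridgeCount, Finset.card_eq_zero, Finset.eq_empty_iff_forall_notMem]
  intro ω hω
  have h := (mem_irreducibleBridges.1 hω).2.1
  omega

/-- The brick-wall irreducible bridges are `ℤ²` irreducible bridges. [cite: DuminilCopinHammond2013, §2.2] -/
theorem irreducibleBridges_subset_zd (n : ℕ) : irreducibleBridges n ⊆ Zd.irreducibleBridges 2 n := by
  intro ω hω
  obtain ⟨hb, hirr⟩ := mem_irreducibleBridges.1 hω
  exact Zd.mem_irreducibleBridges.2 ⟨bridges_subset_zd n hb, hirr⟩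

/-- `0 < λ_1(ℍ)`: the one-step horizontal bridge is irreducible (there is no time in `[1, 0]`). [cite: DuminilCopinHammond2013, §2.2] -/
theorem irreducibleBridgeCount_one_pos : 0 < irreducibleBridgeCount 1 := by
  rw [irreducibleBridgeCount, Finset.card_pos]
  refine ⟨Zd.straightWalk 2 1, mem_irreducibleBridges.2 ⟨straightWalk_mem_bridges 1, le_rfl,
    (mem_bridges.1 (straightWalk_mem_bridges 1)).2, fun k h1 h2 => by omega⟩⟩

/-! ### The renewal inequality -/

/-- **The Lawler–Schramm–Werner renewal inequality on the hexagonal lattice**: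
`Σ_{j=1}^{n} λ_j(ℍ) h_{n-j}(ℍ) ≤ h_n(ℍ)` for every `n` — the twisted gluing of an irreducible `j`-step brick-wall
bridge and an `(n-j)`-step brick-wall half-space walk is an `n`-step half-space walk (`concat_mem_halfSpaceWalks`),
and the gluing is injective in `(j, η, τ)`: `j` is recovered as the least time at which the head is a bridge and
the tail a half-space walk (a smaller such time would be a renewal time of the irreducible head,
`Zd.isRenewalTime_of_halfSpace_tail`).  Printed for `ℤ^d` (tree: `Zd.sum_irreducibleBridgeCount_mul_halfSpaceCount_le`);
not in print for `ℍ`. [cite: LawlerSchrammWerner2004SAW, Appendix A, proof of (A.3), first display ("υ_n = #(Υ_n) ≥ #{ω ∈ Υ_n : s(ω) ≤ k} = Σ_{j=1}^{k} λ_j υ_{n-j}")] -/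
theorem sum_irreducibleBridgeCount_mul_halfSpaceCount_le (n : ℕ) :
    ∑ j ∈ Icc 1 n, irreducibleBridgeCount j * halfSpaceCount (n - j) ≤ halfSpaceCount n := by
  classical
  have hcard : #((Icc 1 n).sigma fun j => irreducibleBridges j ×ˢ halfSpaceWalks (n - j)) =
      ∑ j ∈ Icc 1 n, irreducibleBridgeCount j * halfSpaceCount (n - j) := by
    rw [card_sigma]
    simp_rw [card_product]
    rfl
  rw [← hcard, halfSpaceCount]
  refine Finset.card_le_card_of_injOn (fun p => concat p.1 p.2.1 p.2.2) ?_ ?_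
  · -- the gluing lands in the `n`-step half-space walks
    rintro ⟨j, η, τ⟩ hp
    simp only [mem_coe, mem_sigma, mem_Icc, mem_product] at hp
    obtain ⟨⟨-, hjn⟩, hη, hτ⟩ := hp
    have h := concat_mem_halfSpaceWalks (irreducibleBridges_subset_bridges j hη) hτ
    rw [Nat.add_sub_cancel' hjn] at h
    exact h
  · -- injectivity
    rintro ⟨j, η, τ⟩ hp ⟨j', η', τ'⟩ hp' h
    simp only [mem_coe, mem_sigma, mem_Icc, mem_product] at hp hp'
    obtain ⟨⟨hj1, hjn⟩, hη, hτ⟩ := hp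
    obtain ⟨⟨hj1', hjn'⟩, hη', hτ'⟩ := hp'
    dsimp only at h
    have hηb := irreducibleBridges_subset_bridges j hη
    have hηb' := irreducibleBridges_subset_bridges j' hη'
    have hηZ : η ∈ Zd.saws 2 j := (mem_saws.1 (mem_bridges.1 hηb).1).1
    have hηZ' : η' ∈ Zd.saws 2 j' := (mem_saws.1 (mem_bridges.1 hηb').1).1
    have hτZ : τ ∈ Zd.saws 2 (n - j) := (mem_saws.1 (mem_halfSpaceWalks.1 hτ).1).1
    have hτZ' : τ' ∈ Zd.saws 2 (n - j') := (mem_saws.1 (mem_halfSpaceWalks.1 hτ').1).1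
    -- the twisted tails
    set σ : ℕ → Site 2 := fun k => twistAt (η j) (τ k) with hσ
    set σ' : ℕ → Site 2 := fun k => twistAt (η' j') (τ' k) with hσ'
    have hσZ : σ ∈ Zd.saws 2 (n - j) := twistAt_comp_mem_zdSaws (η j) hτZ
    have hσZ' : σ' ∈ Zd.saws 2 (n - j') := twistAt_comp_mem_zdSaws (η' j') hτZ'
    have hσ0 : σ 0 = 0 := (Zd.mem_saws.1 hσZ).1
    have hσ0' : σ' 0 = 0 := (Zd.mem_saws.1 hσZ').1
    have hce : concat j η τ = Zd.concatWalk j η σ := rfl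
    have hce' : concat j' η' τ' = Zd.concatWalk j' η' σ' := rfl
    rw [hce, hce'] at h
    -- heads are bridges, tails are half-space walks (for both gluings)
    have hB : Zd.IsBridge j (Zd.concatWalk j η σ) := Zd.isBridge_concatWalk_left.2 (mem_bridges.1 hηb).2
    have hB' : Zd.IsBridge j' (Zd.concatWalk j' η' σ') := Zd.isBridge_concatWalk_left.2 (mem_bridges.1 hηb').2
    have hT : Zd.IsHalfSpace (n - j) (fun k => Zd.concatWalk j η σ (j + k)) := by
      have e : (fun k => Zd.concatWalk j η σ (j + k)) = fun k => η j + σ k :=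
        funext fun k => Zd.concatWalk_apply_add η σ hσ0 k
      rw [e, Zd.isHalfSpace_add_const_iff, hσ, isHalfSpace_twistAt_comp_iff]
      exact (mem_halfSpaceWalks.1 hτ).2
    have hT' : Zd.IsHalfSpace (n - j') (fun k => Zd.concatWalk j' η' σ' (j' + k)) := by
      have e : (fun k => Zd.concatWalk j' η' σ' (j' + k)) = fun k => η' j' + σ' k :=
        funext fun k => Zd.concatWalk_apply_add η' σ' hσ0' k
      rw [e, Zd.isHalfSpace_add_const_iff, hσ', isHalfSpace_twistAt_comp_iff]
      exact (mem_halfSpaceWalks.1 hτ').2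
    obtain rfl : j = j' := by
      by_contra hne
      rcases lt_or_gt_of_ne hne with hlt | hlt
      · -- `j < j'`: `j` would be a renewal time of the irreducible `η'`
        rw [h] at hB hT
        have hren := Zd.isRenewalTime_of_halfSpace_tail hB hB' hlt hjn' hT
        have hren' : Zd.IsRenewalTime j' η' j :=
          hren.congr fun i hi => by rw [Zd.concatWalk_apply_of_le η' σ' hi]
        exact (mem_irreducibleBridges.1 hη').2.2.2 j hj1 (by omega) hren'
      · rw [← h] at hB' hT'
        have hren := Zd.isRenewalTime_of_halfSpace_tail hB' hB hlt hjn hT'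
        have hren' : Zd.IsRenewalTime j η j' :=
          hren.congr fun i hi => by rw [Zd.concatWalk_apply_of_le η σ hi]
        exact (mem_irreducibleBridges.1 hη).2.2.2 j' hj1' (by omega) hren'
    obtain ⟨h1, h2⟩ := Zd.concatWalk_injective_pieces hηZ hσZ hηZ' hσZ' h
    subst h1
    have hττ' : τ = τ' := by
      funext k
      have hk := congrFun h2 k
      simp only [hσ, hσ'] at hk
      exact twistAt_injective _ hk
    subst hττ'
    rfl

/-! ### The renewal equation `b_n(ℍ) = Σ_{s=1}^{n} λ_s(ℍ) b_{n-s}(ℍ)` (Madras–Slade (4.2.2) on `ℍ`) -/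

/-- The twisted, translated tail `j ↦ twistAt (ω s) (ω (s + j) - ω s)` of an `n`-step brick-wall walk after time
`s ≤ n` is an `(n-s)`-step brick-wall walk from the origin (the twist repairs the parity of the new origin).
[cite: MadrasSlade1993, §1.2, eq. (1.2.15)] -/
theorem tailTwist_mem_saws {n s : ℕ} {ω : ℕ → Site 2} (hω : ω ∈ saws n) (hs : s ≤ n) :
    (fun j => twistAt (ω s) (ω (s + j) - ω s)) ∈ saws (n - s) := by
  obtain ⟨hZ, hbw⟩ := mem_saws.1 hω
  refine mem_saws.2 ⟨twistAt_comp_mem_zdSaws (ω s) (Zd.tailShift_mem_saws hZ hs), fun i hi => ?_⟩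
  have key : brickWallGraph.Adj (ω (s + i)) (ω (s + (i + 1))) := by
    rw [← add_assoc]; exact hbw (s + i) (by omega)
  rw [← adj_add_twistAt_iff (ω s)]
  have e1 : ω s + twistAt (ω s) (twistAt (ω s) (ω (s + i) - ω s)) = ω (s + i) := by
    rw [twistAt_twistAt]; abel
  have e2 : ω s + twistAt (ω s) (twistAt (ω s) (ω (s + (i + 1)) - ω s)) = ω (s + (i + 1)) := by
    rw [twistAt_twistAt]; abel
  rw [e1, e2]
  exact key

/-- The twisted tail of a brick-wall bridge after a renewal time `s` is an `(n-s)`-step brick-wall bridge.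
[cite: MadrasSlade1993, §4.2, eq. (4.2.2) (p. 90)] -/
theorem tailTwist_mem_bridges {n s : ℕ} {ω : ℕ → Site 2} (hω : ω ∈ bridges n) (hs : Zd.IsRenewalTime n ω s) :
    (fun j => twistAt (ω s) (ω (s + j) - ω s)) ∈ bridges (n - s) :=
  mem_bridges.2 ⟨tailTwist_mem_saws (mem_bridges.1 hω).1 hs.1,
    (isBridge_twistAt_comp_iff (ω s)).2 ((Zd.isBridge_sub_const_iff _).2 hs.2.2)⟩

/-- The head `i ↦ ω (min i s)` of a brick-wall bridge up to its FIRST renewal time `s` is an irreducible `s`-step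
brick-wall bridge. [cite: MadrasSlade1993, §4.2, eq. (4.2.2) (p. 90)] -/
theorem head_mem_irreducibleBridges {n s : ℕ} {ω : ℕ → Site 2} (hω : ω ∈ bridges n) (hs1 : 1 ≤ s)
    (hs : Zd.IsRenewalTime n ω s) (hmin : ∀ k, 1 ≤ k → k < s → ¬ Zd.IsRenewalTime n ω k) :
    (fun i => ω (min i s)) ∈ irreducibleBridges s := by
  have hZ := Zd.headWalk_mem_irreducibleBridges (bridges_subset_zd n hω) hs1 hs hmin
  have hS : ω ∈ saws (s + (n - s)) := by rw [Nat.add_sub_cancel' hs.1]; exact (mem_bridges.1 hω).1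
  exact mem_irreducibleBridges.2 ⟨mem_bridges.2 ⟨prefix_mem hS,
    (Zd.mem_bridges.1 (Zd.irreducibleBridges_subset_bridges s hZ)).2⟩, (Zd.mem_irreducibleBridges.1 hZ).2⟩

/-- A brick-wall walk is the twisted gluing of its head and its twisted tail. [cite: MadrasSlade1993, §4.2, eq. (4.2.2) (p. 90)] -/
theorem concat_head_tailTwist (s : ℕ) (ω : ℕ → Site 2) :
    concat s (fun i => ω (min i s)) (fun j => twistAt (ω s) (ω (s + j) - ω s)) = ω := by
  have e : (fun j => twistAt ((fun i => ω (min i s)) s) ((fun j => twistAt (ω s) (ω (s + j) - ω s)) j)) =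
      fun j => ω (s + j) - ω s := by
    funext j; simp only [min_self, twistAt_twistAt]
  rw [concat, e]
  exact Zd.concatWalk_head_tail ω

/-- **Madras–Slade (4.2.2) on the hexagonal lattice**: `b_n(ℍ) = Σ_{s=1}^{n} λ_s(ℍ) b_{n-s}(ℍ)` for `n ≥ 1` — every
`n`-step brick-wall bridge is, in exactly one way, the twisted gluing of an irreducible `s`-step brick-wall bridge
(`s` = its first renewal time) and an `(n-s)`-step brick-wall bridge.  Printed for `ℤ^d` (tree:
`Zd.bridgeCount_eq_sum_Icc`); not in print for `ℍ`. [cite: MadrasSlade1993, §4.2, eq. (4.2.2) (p. 90)] -/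
theorem bridgeCount_eq_sum_Icc {n : ℕ} (hn : 1 ≤ n) :
    bridgeCount n = ∑ s ∈ Icc 1 n, irreducibleBridgeCount s * bridgeCount (n - s) := by
  classical
  have hcard : #((Icc 1 n).sigma fun s => irreducibleBridges s ×ˢ bridges (n - s)) =
      ∑ s ∈ Icc 1 n, irreducibleBridgeCount s * bridgeCount (n - s) := by
    rw [card_sigma]
    simp_rw [card_product]
    rfl
  rw [← hcard, bridgeCount]
  symm
  refine card_nbij (fun p => concat p.1 p.2.1 p.2.2) ?_ ?_ ?_
  · -- the gluing lands in the `n`-step bridges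
    rintro ⟨s, η, τ⟩ hp
    simp only [mem_coe, mem_sigma, mem_Icc, mem_product] at hp
    obtain ⟨⟨-, hsn⟩, hη, hτ⟩ := hp
    have h := concat_mem_bridges (irreducibleBridges_subset_bridges s hη) hτ
    rwa [Nat.add_sub_cancel' hsn] at h
  · -- injectivity: the gluing time is the first renewal time, then the pieces are determined
    rintro ⟨s, η, τ⟩ hp ⟨s', η', τ'⟩ hp' h
    simp only [mem_coe, mem_sigma, mem_Icc, mem_product] at hp hp'
    obtain ⟨⟨hs1, hsn⟩, hη, hτ⟩ := hp
    obtain ⟨⟨hs1', hsn'⟩, hη', hτ'⟩ := hp'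
    dsimp only at h
    have hηb := irreducibleBridges_subset_bridges s hη
    have hηb' := irreducibleBridges_subset_bridges s' hη'
    have hηZ : η ∈ Zd.saws 2 s := (mem_saws.1 (mem_bridges.1 hηb).1).1
    have hηZ' : η' ∈ Zd.saws 2 s' := (mem_saws.1 (mem_bridges.1 hηb').1).1
    have hτZ : τ ∈ Zd.saws 2 (n - s) := (mem_saws.1 (mem_bridges.1 hτ).1).1
    have hτZ' : τ' ∈ Zd.saws 2 (n - s') := (mem_saws.1 (mem_bridges.1 hτ').1).1
    set σ : ℕ → Site 2 := fun k => twistAt (η s) (τ k) with hσ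
    set σ' : ℕ → Site 2 := fun k => twistAt (η' s') (τ' k) with hσ'
    have hσZ : σ ∈ Zd.saws 2 (n - s) := twistAt_comp_mem_zdSaws (η s) hτZ
    have hσZ' : σ' ∈ Zd.saws 2 (n - s') := twistAt_comp_mem_zdSaws (η' s') hτZ'
    have hσb : σ ∈ Zd.bridges 2 (n - s) :=
      Zd.mem_bridges.2 ⟨hσZ, (isBridge_twistAt_comp_iff (η s)).2 (mem_bridges.1 hτ).2⟩
    have hσb' : σ' ∈ Zd.bridges 2 (n - s') :=
      Zd.mem_bridges.2 ⟨hσZ', (isBridge_twistAt_comp_iff (η' s')).2 (mem_bridges.1 hτ').2⟩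
    have hce : concat s η τ = Zd.concatWalk s η σ := rfl
    have hce' : concat s' η' τ' = Zd.concatWalk s' η' σ' := rfl
    rw [hce, hce'] at h
    have hren := Zd.isRenewalTime_concatWalk hsn (bridges_subset_zd s hηb) hσb
    have hren' := Zd.isRenewalTime_concatWalk hsn' (bridges_subset_zd s' hηb') hσb'
    obtain rfl : s = s' := by
      by_contra hne
      rcases lt_or_gt_of_ne hne with hlt | hlt
      · rw [h] at hren
        exact Zd.not_isRenewalTime_concatWalk_of_lt hsn' (irreducibleBridges_subset_zd s' hη') hs1 hlt hren
      · rw [← h] at hren'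
        exact Zd.not_isRenewalTime_concatWalk_of_lt hsn (irreducibleBridges_subset_zd s hη) hs1' hlt hren'
    obtain ⟨h1, h2⟩ := Zd.concatWalk_injective_pieces hηZ hσZ hηZ' hσZ' h
    subst h1
    have hττ' : τ = τ' := by
      funext k
      have hk := congrFun h2 k
      simp only [hσ, hσ'] at hk
      exact twistAt_injective _ hk
    subst hττ'
    rfl
  · -- surjectivity: split a bridge at its first renewal time and twist the tail
    intro ω hω
    rw [mem_coe] at hω
    obtain ⟨s, hs1, hs, hmin⟩ := Zd.exists_first_renewalTime hn (mem_bridges.1 hω).2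
    refine ⟨⟨s, fun i => ω (min i s), fun j => twistAt (ω s) (ω (s + j) - ω s)⟩, ?_, concat_head_tailTwist s ω⟩
    simp only [mem_coe, mem_sigma, mem_Icc, mem_product]
    exact ⟨⟨hs1, hs.1⟩, head_mem_irreducibleBridges hω hs1 hs hmin, tailTwist_mem_bridges hω hs⟩

/-- The renewal equation in Feller's indexing: `b_n(ℍ) = Σ_{k=0}^{n} λ_k(ℍ) b_{n-k}(ℍ)` for `n ≥ 1` (`λ_0 = 0`).
[cite: MadrasSlade1993, §4.2, eq. (4.2.2) (p. 90)] -/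
theorem bridgeCount_eq_sum_range {n : ℕ} (hn : 1 ≤ n) :
    (bridgeCount n : ℝ) = ∑ k ∈ Finset.range (n + 1), (irreducibleBridgeCount k : ℝ) * bridgeCount (n - k) := by
  rw [bridgeCount_eq_sum_Icc hn, Finset.range_eq_Ico, Nat.cast_sum]
  have h : Finset.Ico 0 (n + 1) = insert 0 (Icc 1 n) := by
    ext k; simp only [Finset.mem_Ico, Finset.mem_insert, mem_Icc]; omega
  rw [h, Finset.sum_insert (by simp), irreducibleBridgeCount_zero]
  push_cast
  ring

end HexBW

end Literature.Probability.RandomPlanarGeometry.SAW
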